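import Literature.Analysis.OperatorTheory.Enflo2023.Basic
import Literature.Analysis.OperatorTheory.Enflo2023.WeakLimitStep
import Literature.Analysis.OperatorTheory.Enflo2023.Reductions
import Literature.Analysis.OperatorTheory.Enflo2023.CompactCase
import Literature.Analysis.InnerProduct.WeakSubsequence
import HarnessLib

/-!
# Enflo 2023, repair census: POLYNOMIALLY COMPACT operators — the disputed step is not needed

Source under adjudication: Per H. Enflo, *On the invariant subspace problem in Hilbert spaces*, arXiv:2305.15442 (v1
2023, v2 2024), bib key `Enflo2023` — a CLAIMED proof of the invariant subspace problem for operators on a separable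
Hilbert space.  This file is part of the kernel-tight typing of the manuscript by the b2b-enflo repair cell
(formaliser 2, Part B: (28)–(47), the limiting argument and the final deduction).  It records what FOLLOWS (proved
implications from the manuscript's displayed hypotheses) and, where a step does not follow, the typed inference
together with its refutation.  NOTHING here asserts that the manuscript's main theorem holds; no declaration concludes
the invariant subspace problem for an arbitrary operator.  Value (BLOCK-2b): theorems / refutations of typed
inferences about a text — not progress on the problem.

REPAIR-CENSUS entry R12 (extends R8 `CompactCase.lean`): "under which stronger hypotheses on `T` does the located gap
of Part B — the room claim of v2 p.20 after (46), i.e. NORM convergence of the Main-Construction outputs, refuted as an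
inference in `RoomClaim.lean` / `RoomClaimFin.lean` — stop being needed?"  Answer recorded here: whenever SOME NON-ZERO
POLYNOMIAL `p(T)` IS COMPACT (polynomially compact operators: `T` compact, `T^m` compact, and every compact perturbation
`A + K` of an ALGEBRAIC operator `A`, `q(A) = 0` — in particular `μ•1 + K`, nilpotent `+ K`, idempotent `+ K`,
`isCompactOperator_aeval_of_add_algebraic`).  Mechanism (the manuscript's own, p.4 before (11)): the MC outputs `w_n`
(`‖x₀‖ = 1`, `0.3 ≤ ‖x₀ − w_n‖ ≤ 0.7`, (9) `|⟨T^j w_n, x₀ − w_n⟩| ≤ (εθ)_n → 0` for all `j`) have a weakly convergent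
subsequence `w_n ⇀ z`; `K := p(T)` compact makes `K w_n → K z` in NORM, and `⟨T^j K w_n, x₀ − w_n⟩` is a FIXED
coefficient combination of the pairings in (9) (`pow_apply_aeval_apply`, `norm_inner_pow_aeval_le`), so
`⟨T^j K z, x₀ − z⟩ = 0` for every `j ≥ 0`; `z ≠ 0` and `x₀ − z ≠ 0` as in `CompactCase.lean`.  If `K z ≠ 0` the orbit
closure of `K z` is the invariant subspace; if `K z = 0` then `z` is an algebraic vector and its orbit spans a
finite-dimensional invariant subspace (`pow_apply_mem_span_of_aeval_eq_zero`, division with remainder as a strong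
induction).  The exported theorems carry NO dimension, separability or injectivity hypothesis: in dimension `≤ 1` the MC
output hypotheses are contradictory (`two_le_finrank_of_MC`) and in finite dimension `≥ 2` an eigenline serves
(`Reductions.lean`).  So in the Bernstein–Robinson–Halmos class [BernsteinRobinson1966, Halmos1966] the manuscript's
p.4 output ALONE yields the conclusion, by a weak limit, without the room claim.  The conclusion for this class is
classical (1966) and NOT claimed new; neither source is used in the proofs.

DIVIDING LINE (census R10, unchanged): compact perturbations of NON-algebraic normal operators (e.g. self-adjoint +
compact) are not covered — no non-zero polynomial in such a `T` need be compact, the quadratic term `⟨N w_n, w_n⟩` does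
not pass to weak limits, and that class is a known open case of the invariant subspace problem.  Nothing here bears on it.

Origin: planner-b2b-enflo-2-g2-0 (formaliser 2, gen 2), 2026-08-18.  Imports: cell modules `Basic`, `WeakLimitStep`,
`Reductions`, `CompactCase`; tree `Literature.Analysis.InnerProduct.WeakSubsequence`; Mathlib.
-/

open scoped InnerProductSpace
open Filter Topology RCLike Polynomial

namespace Literature.Analysis.OperatorTheory.Enflo2023

variable {H : Type*} [NormedAddCommGroup H] [InnerProductSpace ℂ H]

/-! ### Polynomials in `T` against the orbit bounds (9) -/

/-- `T^j (p(T) u) = Σ_{i ≤ deg p} p_i • T^{j+i} u`. [folklore] -/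
lemma pow_apply_aeval_apply (T : H →L[ℂ] H) (p : ℂ[X]) (j : ℕ) (u : H) :
    (T ^ j) (aeval T p u) = ∑ i ∈ Finset.range (p.natDegree + 1), p.coeff i • (T ^ (j + i)) u := by
  rw [aeval_eq_sum_range]
  simp only [FunLike.coe_sum, Finset.sum_apply, smul_apply, map_sum, map_smul, pow_add,
    mul_apply_eq_comp]

/-- If every orbit pairing `⟪x, T^k u⟫` is bounded by `e`, then so is `⟪x, T^j (p(T) u)⟫`, up to the factor
`Σ_i ‖p_i‖`. [folklore] -/
lemma norm_inner_pow_aeval_le (T : H →L[ℂ] H) (p : ℂ[X]) (x u : H) {e : ℝ}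
    (h : ∀ k : ℕ, ‖⟪x, (T ^ k) u⟫_ℂ‖ ≤ e) (j : ℕ) :
    ‖⟪x, (T ^ j) (aeval T p u)⟫_ℂ‖ ≤ (∑ i ∈ Finset.range (p.natDegree + 1), ‖p.coeff i‖) * e := by
  rw [pow_apply_aeval_apply, inner_sum, Finset.sum_mul]
  refine (norm_sum_le _ _).trans (Finset.sum_le_sum fun i _ => ?_)
  rw [inner_smul_right, norm_mul]
  exact mul_le_mul_of_nonneg_left (h (j + i)) (norm_nonneg _)

/-! ### Algebraic vectors: `p(T) z = 0`, `p ≠ 0`, `z ≠ 0` -/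

/-- If `p(T) z = 0` with `p ≠ 0`, every iterate `T^j z` lies in the span of the first `deg p` iterates
(division with remainder, as a strong induction on `j`). [folklore] -/
lemma pow_apply_mem_span_of_aeval_eq_zero (T : H →L[ℂ] H) {p : ℂ[X]} (hp : p ≠ 0) {z : H}
    (hpz : aeval T p z = 0) (j : ℕ) :
    (T ^ j) z ∈ Submodule.span ℂ ((fun i : ℕ => (T ^ i) z) '' ↑(Finset.range p.natDegree)) := by
  induction j using Nat.strong_induction_on with
  | _ j ih =>
    set S := Submodule.span ℂ ((fun i : ℕ => (T ^ i) z) '' ↑(Finset.range p.natDegree)) with hS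
    by_cases hj : j < p.natDegree
    · exact Submodule.subset_span ⟨j, by simpa using hj, rfl⟩
    · obtain ⟨m, rfl⟩ : ∃ m, j = m + p.natDegree := ⟨j - p.natDegree, by omega⟩
      -- apply `T^m` to `p(T) z = 0` and split off the leading term
      have h0 : ∑ i ∈ Finset.range (p.natDegree + 1), p.coeff i • (T ^ (m + i)) z = 0 := by
        rw [← pow_apply_aeval_apply, hpz, map_zero]
      rw [Finset.sum_range_succ] at h0
      have hlead : p.coeff p.natDegree • (T ^ (m + p.natDegree)) z
          = -(∑ i ∈ Finset.range p.natDegree, p.coeff i • (T ^ (m + i)) z) :=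
        eq_neg_of_add_eq_zero_right h0
      have hmem : p.coeff p.natDegree • (T ^ (m + p.natDegree)) z ∈ S := by
        rw [hlead]
        refine S.neg_mem (S.sum_mem fun i hi => S.smul_mem _ (ih (m + i) ?_))
        have := Finset.mem_range.mp hi
        omega
      have hc : p.coeff p.natDegree ≠ 0 := by
        rw [Polynomial.coeff_natDegree]; exact leadingCoeff_ne_zero.mpr hp
      exact (S.smul_mem_iff hc).mp hmem

/-- Hence the orbit of an algebraic vector spans a FINITE-DIMENSIONAL invariant subspace; if `z ≠ 0` and `H` is
infinite-dimensional this is a non-trivial closed invariant subspace.  (The finite-dimensional case of the theorem is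
`hasNontrivialClosedInvariantSubspace_of_finiteDimensional`, `Reductions.lean`.) [folklore] -/
theorem hasNontrivialClosedInvariantSubspace_of_aeval_apply_eq_zero (T : H →L[ℂ] H) {p : ℂ[X]} (hp : p ≠ 0)
    {z : H} (hz : z ≠ 0) (hpz : aeval T p z = 0) (hH : ¬ FiniteDimensional ℂ H) :
    HasNontrivialClosedInvariantSubspace T := by
  set M := Submodule.span ℂ (Set.range fun j : ℕ => (T ^ j) z) with hM
  have hle : M ≤ Submodule.span ℂ ((fun i : ℕ => (T ^ i) z) '' ↑(Finset.range p.natDegree)) := by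
    rw [Submodule.span_le]
    rintro _ ⟨j, rfl⟩
    exact pow_apply_mem_span_of_aeval_eq_zero T hp hpz j
  have hfin : FiniteDimensional ℂ M := by
    have : FiniteDimensional ℂ
        (Submodule.span ℂ ((fun i : ℕ => (T ^ i) z) '' ↑(Finset.range p.natDegree))) :=
      FiniteDimensional.span_of_finite ℂ ((Finset.finite_toSet _).image _)
    exact Submodule.finiteDimensional_of_le hle
  refine ⟨M, M.closed_of_finiteDimensional, ?_, ?_, ?_⟩
  · intro hbot
    have : z ∈ M := Submodule.subset_span ⟨0, by simp⟩
    rw [hbot, Submodule.mem_bot] at this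
    exact hz this
  · intro htop
    apply hH
    rw [htop] at hfin
    exact Module.Finite.of_surjective (Submodule.topEquiv (R := ℂ) (M := H)).toLinearMap
      (Submodule.topEquiv).surjective
  · intro x hx
    have hmap : M.map (T : H →ₗ[ℂ] H) ≤ M := by
      rw [hM, Submodule.map_span_le]
      rintro _ ⟨j, rfl⟩
      refine Submodule.subset_span ⟨j + 1, ?_⟩
      simp [pow_succ', mul_apply_eq_comp]
    exact hmap ⟨x, hx, rfl⟩

/-! ### The MC hypotheses force `dim H ≥ 2` -/

/-- The p.4 output hypotheses are inconsistent in dimension `≤ 1`: there every `w` is a multiple of `x₀` and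
`|⟨x₀ − w, w⟩| = ‖x₀ − w‖·‖w‖ ≥ 0.3·0.3`, which cannot tend to `0`.  So a finite-dimensional `H` carrying MC outputs
has `dim H ≥ 2` and the finite-dimensional case `hasNontrivialClosedInvariantSubspace_of_finiteDimensional`
(`Reductions.lean`) applies. [folklore] -/
lemma two_le_finrank_of_MC [FiniteDimensional ℂ H] (x₀ : H) (hx₀ : ‖x₀‖ = 1) (w : ℕ → H) (ε : ℕ → ℝ)
    (hdist : ∀ n, 0.3 ≤ ‖x₀ - w n‖ ∧ ‖x₀ - w n‖ ≤ 0.7) (hε : Tendsto ε atTop (𝓝 0))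
    (h0 : ∀ n, ‖⟪x₀ - w n, w n⟫_ℂ‖ ≤ ε n) : 2 ≤ Module.finrank ℂ H := by
  have hx : x₀ ≠ 0 := by
    intro h; rw [h, norm_zero] at hx₀; exact zero_ne_one hx₀
  have h1 : 0 < Module.finrank ℂ H := Module.finrank_pos_iff_exists_ne_zero.mpr ⟨x₀, hx⟩
  by_contra hlt
  have hr1 : Module.finrank ℂ H = 1 := by omega
  obtain ⟨n, hn⟩ : ∃ n, ε n < 0.09 := ((tendsto_order.1 hε).2 _ (by norm_num)).exists
  obtain ⟨c, hc⟩ := (finrank_eq_one_iff_of_nonzero' x₀ hx).mp hr1 (w n)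
  have hnw : (0.3 : ℝ) ≤ ‖w n‖ := by
    have := norm_le_norm_sub_add x₀ (w n)
    rw [hx₀] at this
    linarith [(hdist n).2]
  have key : ‖⟪x₀ - w n, w n⟫_ℂ‖ = ‖x₀ - w n‖ * ‖w n‖ := by
    have e1 : x₀ - w n = (1 - c) • x₀ := by rw [← hc, sub_smul, one_smul]
    rw [e1, ← hc, inner_smul_left, inner_smul_right, inner_self_eq_norm_sq_to_K, hx₀, norm_smul, norm_smul,
      hx₀, norm_mul, norm_mul, RCLike.norm_conj]
    norm_num
  have : (0.09 : ℝ) ≤ ‖⟪x₀ - w n, w n⟫_ℂ‖ := by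
    rw [key]; nlinarith [(hdist n).1, hnw]
  linarith [h0 n]

/-! ### Polynomially compact operators: the type-1 endgame closes from a weak limit -/

/-- REPAIR CENSUS, `p(T)` compact for some polynomial `p ≠ 0` (POLYNOMIALLY COMPACT `T`; includes `T` compact,
`T^m` compact, and every compact perturbation of an ALGEBRAIC operator): the type-1 endgame of the Main Construction
closes from a WEAK limit, exactly as in the compact case.  Hypotheses: `H` infinite-dimensional, `‖x₀‖ = 1`, MC outputs
`w n` with `0.3 ≤ ‖x₀ − w n‖ ≤ 0.7`, the minimality consequence (9) `|⟨T^j w_n, x₀ − w_n⟩| ≤ (εθ)_n` for all `j` with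
`(εθ)_n → 0`, and `w n ⇀ z` weakly.  Proof: `K := p(T)` is compact, so `K w_n → K z` in norm and
`⟨T^j K z, x₀ − z⟩ = lim ⟨T^j K w_n, x₀ − w_n⟩ = 0` (the pairing is a fixed coefficient combination of the (9)
pairings); if `K z ≠ 0` the orbit closure of `K z` is the invariant subspace, and if `K z = 0` the orbit of `z ≠ 0`
spans a finite-dimensional one.  No injectivity of `T`, no norm convergence, no room claim.  The conclusion for this
class is classical — Bernstein–Robinson 1966 [cite: BernsteinRobinson1966] / Halmos 1966 [cite: Halmos1966]: polynomially
compact operators have invariant subspaces — and is not claimed new; neither source is used. [cite: Enflo2023, v2 p.4 (11) and p.20] -/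
theorem hasNontrivialClosedInvariantSubspace_of_polyCompact_weakMC [CompleteSpace H] (T : H →L[ℂ] H)
    {p : ℂ[X]} (hp : p ≠ 0) (hK : IsCompactOperator (aeval T p)) (hH : ¬ FiniteDimensional ℂ H)
    (x₀ : H) (hx₀ : ‖x₀‖ = 1) (w : ℕ → H) (z : H) (ε : ℕ → ℝ)
    (hdist : ∀ n, 0.3 ≤ ‖x₀ - w n‖ ∧ ‖x₀ - w n‖ ≤ 0.7)
    (hweak : ∀ v : H, Tendsto (fun n => ⟪v, w n⟫_ℂ) atTop (𝓝 ⟪v, z⟫_ℂ))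
    (hε : Tendsto ε atTop (𝓝 0))
    (h : ∀ n j, ‖⟪x₀ - w n, (T ^ j) (w n)⟫_ℂ‖ ≤ ε n) :
    HasNontrivialClosedInvariantSubspace T := by
  set K : H →L[ℂ] H := aeval T p with hKdef
  have hB : ∀ n, ‖w n‖ ≤ 1.7 := fun n => norm_le_of_norm_sub_le hx₀ (hdist n).2
  have hB' : ∀ n, ‖x₀ - w n‖ ≤ 0.7 := fun n => (hdist n).2
  have hweak' : ∀ v : H, Tendsto (fun n => ⟪v, x₀ - w n⟫_ℂ) atTop (𝓝 ⟪v, x₀ - z⟫_ℂ) := fun v => by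
    simp_rw [inner_sub_right]
    exact tendsto_const_nhds.sub (hweak v)
  -- compactness of K: K w_n → K z in norm, hence T^j K w_n → T^j K z in norm
  have hKw : Tendsto (fun n => K (w n)) atTop (𝓝 (K z)) := tendsto_of_isCompactOperator_of_tendsto_inner hK hB hweak
  have hTjK : ∀ j : ℕ, Tendsto (fun n => (T ^ j) (K (w n))) atTop (𝓝 ((T ^ j) (K z))) := fun j =>
    ((T ^ j).continuous.tendsto _).comp hKw
  -- pass the (9)-bounds to the limit through K
  have horth : ∀ j : ℕ, ⟪x₀ - z, (T ^ j) (K z)⟫_ℂ = 0 := fun j => by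
    have h1 : Tendsto (fun n => ⟪x₀ - w n, (T ^ j) (K (w n))⟫_ℂ) atTop (𝓝 ⟪x₀ - z, (T ^ j) (K z)⟫_ℂ) :=
      tendsto_inner_of_tendsto_inner_of_tendsto hB' hweak' (hTjK j)
    have h2 : Tendsto (fun n => ‖⟪x₀ - w n, (T ^ j) (K (w n))⟫_ℂ‖) atTop (𝓝 0) := by
      have hb : ∀ n, ‖⟪x₀ - w n, (T ^ j) (K (w n))⟫_ℂ‖
          ≤ (∑ i ∈ Finset.range (p.natDegree + 1), ‖p.coeff i‖) * ε n := fun n =>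
        norm_inner_pow_aeval_le T p (x₀ - w n) (w n) (fun k => h n k) j
      exact squeeze_zero (fun n => norm_nonneg _) hb (by simpa using hε.const_mul _)
    exact norm_eq_zero.mp (tendsto_nhds_unique h1.norm h2)
  -- non-degeneracy of the limit
  have hz : z ≠ 0 :=
    weakLimit_ne_zero (by norm_num) hweak fun n => re_inner_ge_of_norm_sub_le hx₀ (hdist n).2
  have hxz : x₀ - z ≠ 0 :=
    sub_weakLimit_ne_zero hx₀ (fun n => (hdist n).1) hweak hε fun n => by simpa using h n 0
  by_cases hKz : K z = 0
  · exact hasNontrivialClosedInvariantSubspace_of_aeval_apply_eq_zero T hp hz hKz hH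
  · exact hasNontrivialClosedInvariantSubspace_of_orbit_orthogonal' T hKz hxz horth

/-- The same with the weakly convergent subsequence extracted inside Lean and WITHOUT any dimension or separability
hypothesis: for a polynomially compact `T` on a complex Hilbert space, ANY sequence of MC outputs as on p.4 of the
manuscript yields a non-trivial closed invariant subspace (finite dimension: `two_le_finrank_of_MC` + an eigenline;
infinite dimension: the weak-limit argument). [cite: Enflo2023, v2 p.4 (11) and p.20] -/
theorem hasNontrivialClosedInvariantSubspace_of_polyCompact_MC [CompleteSpace H] (T : H →L[ℂ] H)
    {p : ℂ[X]} (hp : p ≠ 0) (hK : IsCompactOperator (aeval T p))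
    (x₀ : H) (hx₀ : ‖x₀‖ = 1) (w : ℕ → H) (ε : ℕ → ℝ)
    (hdist : ∀ n, 0.3 ≤ ‖x₀ - w n‖ ∧ ‖x₀ - w n‖ ≤ 0.7)
    (hε : Tendsto ε atTop (𝓝 0))
    (h : ∀ n j, ‖⟪x₀ - w n, (T ^ j) (w n)⟫_ℂ‖ ≤ ε n) :
    HasNontrivialClosedInvariantSubspace T := by
  by_cases hH : FiniteDimensional ℂ H
  · exact hasNontrivialClosedInvariantSubspace_of_finiteDimensional
      (two_le_finrank_of_MC x₀ hx₀ w ε hdist hε fun n => by simpa using h n 0) T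
  have hB : ∀ n, ‖w n‖ ≤ 1.7 := fun n => norm_le_of_norm_sub_le hx₀ (hdist n).2
  obtain ⟨φ, z, hφ, -, hweak⟩ :=
    Literature.Analysis.InnerProduct.exists_strictMono_tendsto_inner_of_norm_le (𝕜 := ℂ) hB
  exact hasNontrivialClosedInvariantSubspace_of_polyCompact_weakMC T hp hK hH x₀ hx₀ (w ∘ φ) z (ε ∘ φ)
    (fun n => hdist (φ n)) hweak (hε.comp hφ.tendsto_atTop) fun n j => h (φ n) j

/-! ### Compact perturbations of algebraic operators are polynomially compact -/

/-- `(A + K)^n − A^n` is compact when `K` is (compact operators form a two-sided ideal). [folklore] -/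
lemma isCompactOperator_add_pow_sub_pow (A K : H →L[ℂ] H) (hK : IsCompactOperator K) (n : ℕ) :
    IsCompactOperator ((A + K) ^ n - A ^ n : H →L[ℂ] H) := by
  induction n with
  | zero =>
    rw [pow_zero, pow_zero, sub_self]
    exact (compactOperator (RingHom.id ℂ) H H).zero_mem
  | succ n ih =>
    have e : (A + K) ^ (n + 1) - A ^ (n + 1) = (A + K) * ((A + K) ^ n - A ^ n) + K * A ^ n := by
      rw [pow_succ', pow_succ']; noncomm_ring
    rw [e]
    exact (compactOperator (RingHom.id ℂ) H H).add_mem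
      (show IsCompactOperator (((A + K) * ((A + K) ^ n - A ^ n) : H →L[ℂ] H)) from ih.clm_comp (A + K))
      (show IsCompactOperator ((K * A ^ n : H →L[ℂ] H)) from hK.comp_clm (A ^ n))

/-- `q(A + K) − q(A)` is compact when `K` is. [folklore] -/
lemma isCompactOperator_aeval_add_sub_aeval (A K : H →L[ℂ] H) (hK : IsCompactOperator K) (q : ℂ[X]) :
    IsCompactOperator (aeval (A + K) q - aeval A q : H →L[ℂ] H) := by
  have e : aeval (A + K) q - aeval A q
      = ∑ i ∈ Finset.range (q.natDegree + 1), q.coeff i • ((A + K) ^ i - A ^ i) := by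
    rw [aeval_eq_sum_range, aeval_eq_sum_range, ← Finset.sum_sub_distrib]
    refine Finset.sum_congr rfl fun i _ => ?_
    rw [smul_sub]
  rw [e]
  exact (compactOperator (RingHom.id ℂ) H H).sum_mem fun i _ =>
    (compactOperator (RingHom.id ℂ) H H).smul_mem _ (isCompactOperator_add_pow_sub_pow A K hK i)

/-- Hence a compact perturbation `T = A + K` of an ALGEBRAIC operator `A` (`q(A) = 0`, `q ≠ 0`) is polynomially compact:
`q(T)` is compact. Examples: `A = μ•1` (`q = X − μ`), `A` nilpotent (`q = X^m`), `A` idempotent (`q = X² − X`). [folklore] -/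
lemma isCompactOperator_aeval_of_add_algebraic (A K : H →L[ℂ] H) (hK : IsCompactOperator K) {q : ℂ[X]}
    (hqA : aeval A q = 0) : IsCompactOperator (aeval (A + K) q : H →L[ℂ] H) := by
  simpa [hqA] using isCompactOperator_aeval_add_sub_aeval A K hK q

/-- REPAIR CENSUS, compact perturbation of an algebraic operator (`T = A + K`, `q(A) = 0`, `q ≠ 0`, `K` compact; in
particular `T = μ•1 + K`): the manuscript's type-1 endgame closes from a weak limit of the MC outputs — no room claim.
(Compact perturbations of NON-algebraic normal operators, e.g. self-adjoint + compact, are NOT covered: no non-zero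
polynomial in `T` need be compact, and that class is a known open case of the invariant subspace problem.)
[cite: Enflo2023, v2 p.4 (11) and p.20] -/
theorem hasNontrivialClosedInvariantSubspace_of_algebraic_add_compact_MC [CompleteSpace H] (A K : H →L[ℂ] H)
    (hK : IsCompactOperator K) {q : ℂ[X]} (hq : q ≠ 0) (hqA : aeval A q = 0)
    (x₀ : H) (hx₀ : ‖x₀‖ = 1) (w : ℕ → H) (ε : ℕ → ℝ)
    (hdist : ∀ n, 0.3 ≤ ‖x₀ - w n‖ ∧ ‖x₀ - w n‖ ≤ 0.7)
    (hε : Tendsto ε atTop (𝓝 0))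
    (h : ∀ n j, ‖⟪x₀ - w n, ((A + K) ^ j) (w n)⟫_ℂ‖ ≤ ε n) :
    HasNontrivialClosedInvariantSubspace (A + K) :=
  hasNontrivialClosedInvariantSubspace_of_polyCompact_MC (A + K) hq
    (isCompactOperator_aeval_of_add_algebraic A K hK hqA) x₀ hx₀ w ε hdist hε h

/-- Special case `T − μ•1` compact (compact perturbation of a scalar). [cite: Enflo2023, v2 p.4 (11) and p.20] -/
theorem hasNontrivialClosedInvariantSubspace_of_sub_scalar_compact_MC [CompleteSpace H] (T : H →L[ℂ] H) (μ : ℂ)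
    (hK : IsCompactOperator (T - μ • (1 : H →L[ℂ] H) : H →L[ℂ] H))
    (x₀ : H) (hx₀ : ‖x₀‖ = 1) (w : ℕ → H) (ε : ℕ → ℝ)
    (hdist : ∀ n, 0.3 ≤ ‖x₀ - w n‖ ∧ ‖x₀ - w n‖ ≤ 0.7)
    (hε : Tendsto ε atTop (𝓝 0))
    (h : ∀ n j, ‖⟪x₀ - w n, (T ^ j) (w n)⟫_ℂ‖ ≤ ε n) :
    HasNontrivialClosedInvariantSubspace T := by
  have hp : (X - C μ : ℂ[X]) ≠ 0 := X_sub_C_ne_zero μ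
  have hK' : IsCompactOperator (aeval T (X - C μ) : H →L[ℂ] H) := by
    simpa [Algebra.algebraMap_eq_smul_one] using hK
  exact hasNontrivialClosedInvariantSubspace_of_polyCompact_MC T hp hK' x₀ hx₀ w ε hdist hε h

/-- Special case `T^m` compact for some `m` (power-compact operators; for `m ≥ 1` this class strictly contains the
compact operators). [cite: Enflo2023, v2 p.4 (11) and p.20] -/
theorem hasNontrivialClosedInvariantSubspace_of_pow_compact_MC [CompleteSpace H] (T : H →L[ℂ] H) (m : ℕ)
    (hK : IsCompactOperator (T ^ m))
    (x₀ : H) (hx₀ : ‖x₀‖ = 1) (w : ℕ → H) (ε : ℕ → ℝ)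
    (hdist : ∀ n, 0.3 ≤ ‖x₀ - w n‖ ∧ ‖x₀ - w n‖ ≤ 0.7)
    (hε : Tendsto ε atTop (𝓝 0))
    (h : ∀ n j, ‖⟪x₀ - w n, (T ^ j) (w n)⟫_ℂ‖ ≤ ε n) :
    HasNontrivialClosedInvariantSubspace T := by
  have hp : (X ^ m : ℂ[X]) ≠ 0 := pow_ne_zero m X_ne_zero
  have hK' : IsCompactOperator (aeval T (X ^ m : ℂ[X]) : H →L[ℂ] H) := by simpa using hK
  exact hasNontrivialClosedInvariantSubspace_of_polyCompact_MC T hp hK' x₀ hx₀ w ε hdist hε h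

end Literature.Analysis.OperatorTheory.Enflo2023
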